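import Summits.NavierStokesRegularity.NavierStokesRegularity.Theorems.PalasekTowerBreakdownEpisodeBaseStrainPairing

/-!
# Strain-currency pairing lemmas, Part II: the level-1 STRETCHING term against the Laplacian

Cell `ns-blowup`, seat `ns-palasek-19179-p2` (g6; holder-of-record lineage of crux
stmt-NavierStokesRegularity-19179 `EpisodeBase`, route `PalasekTowerBreakdown`; `--supports
stmt-NavierStokesRegularity-19179`). Sequel of `PalasekTowerBreakdownEpisodeBaseStrainPairing.lean` (Part I: the
linear-algebra lemma, level 0, whole-space integration by parts, the level-1 TRANSPORT identity and bound), for the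
stub `stub_strain_door : StrainDoor` of the strategist line `Cruxes/EpisodeBase/Lines/straindoor.lean` (cstrat-19179,
v2). LABEL: E–C analysis (KERNEL: theorems only; no definition, no named fact, no `sorry`; register-free). WHAT THIS
IS NOT: not Navier–Stokes evidence — whole-space calculus identities and bounds for two given fields; no flow, run,
design or blow-up is exhibited or asserted.

## What is proved (`u : E → E` the reference with bounded derivatives, `v : E → E` a smooth `L²` field)

* `integral_inner_convect_laplacian_eq_neg_sum_sub` (level 1, stretching IDENTITY) —
  `∫ ⟪(v·∇)u, Δv⟫ = −∑ₖ ∫ ⟪Du (∂ₖv), ∂ₖv⟫ − ∑ₖ ∫ ⟪D²u (bₖ) (v), ∂ₖv⟫` (one integration by parts per coordinate;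
  no divergence condition).
* `abs_integral_inner_convect_laplacian_le_of_strain_of_hess` (level 1, stretching BOUND) — under the strain
  majorant `|⟪Du(x) ξ, ξ⟫| ≤ σ ‖ξ‖²` and the Hessian majorant `‖D²u(x)‖ ≤ σ₂`:
  `|∫ ⟪(v·∇)u, Δv⟫| ≤ σ ∑ₖ ∫ ‖∂ₖv‖² + σ₂ ∫ ‖v‖ ∑ₖ ‖∂ₖv‖` — the STRAIN of `u` plus one Hessian cross term, no
  `‖Du‖_∞` (with Part I's transport bound this gives the `H¹`-level coefficient `4σ` of the strain-currency energy
  inequality for the difference of a free run and a pseudo-run).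

References: C. R. Doering, J. D. Gibbon, *Applied Analysis of the Navier–Stokes Equations*, CUP 1995, §2.3
[cite: DoeringGibbon1995, §2.3 (2.3.29)–(2.3.31)]; P. Constantin, C. Foias, *Navier–Stokes Equations*, Univ.
Chicago Press 1988, Ch. 10 [cite: ConstantinFoiasNSE1988, Ch. 10 Thm. 10.2].
-/

noncomputable section

set_option linter.dupNamespace false

open MeasureTheory Filter Function Set
open scoped ENNReal NNReal RealInnerProductSpace Topology Laplacian
open Literature.Analysis.FunctionSpaces Literature.Analysis.FluidPDE

namespace Summit.NavierStokesRegularity.NavierStokesRegularity.Theorems.StrainPairing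

variable {E : Type*} [NormedAddCommGroup E] [InnerProductSpace ℝ E] [FiniteDimensional ℝ E]
  [MeasurableSpace E] [BorelSpace E]

/-! ## Level 1: the stretching term against the Laplacian -/

section Stretching

/-- **Level 1, stretching IDENTITY.** For a reference `u : E → E` with bounded derivatives and a smooth `L²`
field `v : E → E`: `∫ ⟪(v·∇)u, Δv⟫ = −∑ₖ ∫ ⟪Du (∂ₖv), ∂ₖv⟫ − ∑ₖ ∫ ⟪(D²u bₖ) v, ∂ₖv⟫` (one integration by
parts per coordinate; `∂ₖ[(v·∇)u] = Du(∂ₖ v) + D²u(bₖ, v)`). No divergence condition is used.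
[cite: ConstantinFoiasNSE1988, Ch. 10 Thm. 10.2] -/
theorem integral_inner_convect_laplacian_eq_neg_sum_sub {u v : E → E} (hu : HasBoundedDerivs u)
    (hv : IsSmoothL2Field v) :
    ∫ x, ⟪convect v u x, (Δ v) x⟫ =
      -(∑ k, ∫ x, ⟪fderiv ℝ u x (fderiv ℝ v x (stdOrthonormalBasis ℝ E k)),
          fderiv ℝ v x (stdOrthonormalBasis ℝ E k)⟫) -
        ∑ k, ∫ x, ⟪fderiv ℝ (fderiv ℝ u) x (stdOrthonormalBasis ℝ E k) (v x),
          fderiv ℝ v x (stdOrthonormalBasis ℝ E k)⟫ := by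
  set b := stdOrthonormalBasis ℝ E with hb
  obtain ⟨M₁, hM₁⟩ := hu.exists_norm_fderiv_le
  obtain ⟨M₂, hM₂⟩ := hu.fderiv.exists_norm_fderiv_le
  have hu1 : ContDiff ℝ 1 u := hu.contDiff_nat 1
  have hu2 : ContDiff ℝ 2 u := hu.contDiff_nat 2
  have hv1 : ContDiff ℝ 1 v := hv.contDiff_nat 1
  have hv2 : ContDiff ℝ 2 v := hv.contDiff_nat 2
  -- the field `F = (v·∇)u = Du(v)` is `C¹`, in `L²`, with `∂ₖF ∈ L²`
  set F : E → E := convect v u with hF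
  have hFdef : F = fun y => (fderiv ℝ u y) (v y) := by funext y; rfl
  have hF1 : ContDiff ℝ 1 F := by
    rw [hFdef]; exact (hu2.fderiv_right (m := 1) le_rfl).clm_apply hv1
  have hFm : MemLp F 2 volume := by
    refine MemLp.of_le_mul (c := M₁) hv.memLp_two hF1.continuous.aestronglyMeasurable
      (Eventually.of_forall fun x => ?_)
    rw [hFdef]
    exact (ContinuousLinearMap.le_opNorm _ _).trans (mul_le_mul_of_nonneg_right (hM₁ x) (norm_nonneg _))
  -- `∂ₖ F = Du (∂ₖ v) + (D²u bₖ) v`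
  have hdF : ∀ k x, fderiv ℝ F x (b k) =
      fderiv ℝ u x (fderiv ℝ v x (b k)) + fderiv ℝ (fderiv ℝ u) x (b k) (v x) := by
    intro k x
    have hdu : DifferentiableAt ℝ (fderiv ℝ u) x :=
      ((hu2.fderiv_right (m := 1) le_rfl).differentiable one_ne_zero) x
    have hdv : DifferentiableAt ℝ v x := (hv1.differentiable one_ne_zero) x
    rw [hFdef, fderiv_clm_apply hdu hdv]
    simp only [add_apply, ContinuousLinearMap.coe_comp, Function.comp_apply,
      ContinuousLinearMap.flip_apply]
  have hT1m : ∀ k, MemLp (fun x => fderiv ℝ u x (fderiv ℝ v x (b k))) 2 volume := by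
    intro k
    refine MemLp.of_le_mul (c := M₁) ((hv.fderiv_apply (b k)).memLp_two) ?_
      (Eventually.of_forall fun x => ?_)
    · exact ((hu1.continuous_fderiv one_ne_zero).clm_apply
        ((hv1.continuous_fderiv one_ne_zero).clm_apply continuous_const)).aestronglyMeasurable
    · exact (ContinuousLinearMap.le_opNorm _ _).trans
        (mul_le_mul_of_nonneg_right (hM₁ x) (norm_nonneg _))
  have hT2m : ∀ k, MemLp (fun x => fderiv ℝ (fderiv ℝ u) x (b k) (v x)) 2 volume := by
    intro k
    refine MemLp.of_le_mul (c := M₂) hv.memLp_two ?_ (Eventually.of_forall fun x => ?_)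
    · exact ((((hu2.fderiv_right (m := 1) le_rfl).continuous_fderiv one_ne_zero).clm_apply continuous_const).clm_apply
        hv.continuous).aestronglyMeasurable
    · calc ‖fderiv ℝ (fderiv ℝ u) x (b k) (v x)‖ ≤ ‖fderiv ℝ (fderiv ℝ u) x (b k)‖ * ‖v x‖ :=
          ContinuousLinearMap.le_opNorm _ _
        _ ≤ ‖fderiv ℝ (fderiv ℝ u) x‖ * ‖b k‖ * ‖v x‖ := by
          gcongr; exact ContinuousLinearMap.le_opNorm _ _
        _ ≤ M₂ * ‖v x‖ := by
          rw [b.orthonormal.1 k, mul_one]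
          exact mul_le_mul_of_nonneg_right (hM₂ x) (norm_nonneg _)
  -- the `k`-th term
  have hk : ∀ k, ∫ x, ⟪F x, fderiv ℝ (fun y => fderiv ℝ v y (b k)) x (b k)⟫ =
      -(∫ x, ⟪fderiv ℝ u x (fderiv ℝ v x (b k)), fderiv ℝ v x (b k)⟫) -
        ∫ x, ⟪fderiv ℝ (fderiv ℝ u) x (b k) (v x), fderiv ℝ v x (b k)⟫ := by
    intro k
    set G : E → E := fun y => fderiv ℝ v y (b k) with hG
    have hGS : IsSmoothL2Field G := hv.fderiv_apply (b k)
    have hdFm : MemLp (fun x => fderiv ℝ F x (b k)) 2 volume := by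
      have : (fun x => fderiv ℝ F x (b k)) =
          (fun x => fderiv ℝ u x (fderiv ℝ v x (b k))) + fun x => fderiv ℝ (fderiv ℝ u) x (b k) (v x) := by
        funext x; simp only [Pi.add_apply, hdF]
      rw [this]; exact (hT1m k).add (hT2m k)
    have h₁ : Integrable (fun x => ⟪fderiv ℝ F x (b k), G x⟫) volume :=
      integrable_inner_of_memLp_two hdFm hGS.memLp_two
    have h₂ : Integrable (fun x => ⟪F x, fderiv ℝ G x (b k)⟫) volume :=
      integrable_inner_of_memLp_two hFm (hGS.memLp_fderiv_apply (b k))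
    have h₃ : Integrable (fun x => ⟪F x, G x⟫) volume := integrable_inner_of_memLp_two hFm hGS.memLp_two
    rw [integral_inner_fderiv_apply_eq_neg hF1 (hGS.contDiff_nat 1) (b k) h₁ h₂ h₃]
    simp_rw [hdF, inner_add_left]
    rw [integral_add (integrable_inner_of_memLp_two (hT1m k) hGS.memLp_two)
      (integrable_inner_of_memLp_two (hT2m k) hGS.memLp_two), neg_add', hG]
  have hrep : ∀ x, ⟪F x, (Δ v) x⟫ =
      ∑ k, ⟪F x, fderiv ℝ (fun y => fderiv ℝ v y (b k)) x (b k)⟫ := by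
    intro x
    rw [laplacian_eq_sum_fderiv_fderiv b hv2 x, inner_sum]
  simp_rw [hrep]
  rw [integral_finsetSum _ fun k _ => ?_]
  · simp_rw [hk]
    rw [Finset.sum_sub_distrib, Finset.sum_neg_distrib]
  · exact integrable_inner_of_memLp_two hFm ((hv.fderiv_apply (b k)).memLp_fderiv_apply (b k))

/-- **Level 1, stretching BOUND in strain currency.** For a reference `u : E → E` with bounded derivatives,
`|⟪Du(x) ξ, ξ⟫| ≤ σ ‖ξ‖²` and `‖D²u(x)‖ ≤ σ₂`, and a smooth `L²` field `v : E → E`: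
`|∫ ⟪(v·∇)u, Δv⟫| ≤ σ ∑ₖ ∫ ‖∂ₖv‖² + σ₂ ∫ ‖v‖ ∑ₖ ‖∂ₖv‖` — the stretching term against the Laplacian costs
the STRAIN of `u` plus a Hessian cross term (no `‖Du‖_∞`). [cite: DoeringGibbon1995, §2.3 (2.3.29)–(2.3.31)]
[cite: ConstantinFoiasNSE1988, Ch. 10 Thm. 10.2] -/
theorem abs_integral_inner_convect_laplacian_le_of_strain_of_hess {u v : E → E} (hu : HasBoundedDerivs u)
    (hv : IsSmoothL2Field v) {σ σ₂ : ℝ} (hσ : ∀ x ξ : E, |⟪fderiv ℝ u x ξ, ξ⟫| ≤ σ * ‖ξ‖ ^ 2)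
    (hσ₂ : ∀ x, ‖fderiv ℝ (fderiv ℝ u) x‖ ≤ σ₂) :
    |∫ x, ⟪convect v u x, (Δ v) x⟫| ≤
      σ * (∑ k, ∫ x, ‖fderiv ℝ v x (stdOrthonormalBasis ℝ E k)‖ ^ 2) +
        σ₂ * ∫ x, ‖v x‖ * ∑ k, ‖fderiv ℝ v x (stdOrthonormalBasis ℝ E k)‖ := by
  set b := stdOrthonormalBasis ℝ E with hb
  obtain ⟨M₁, hM₁⟩ := hu.exists_norm_fderiv_le
  obtain ⟨M₂, hM₂⟩ := hu.fderiv.exists_norm_fderiv_le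
  have hu1 : ContDiff ℝ 1 u := hu.contDiff_nat 1
  have hu2 : ContDiff ℝ 2 u := hu.contDiff_nat 2
  have hv1 : ContDiff ℝ 1 v := hv.contDiff_nat 1
  -- integrability of the summands
  have hT1m : ∀ k, MemLp (fun x => fderiv ℝ u x (fderiv ℝ v x (b k))) 2 volume := by
    intro k
    refine MemLp.of_le_mul (c := M₁) ((hv.fderiv_apply (b k)).memLp_two) ?_
      (Eventually.of_forall fun x => ?_)
    · exact ((hu1.continuous_fderiv one_ne_zero).clm_apply
        ((hv1.continuous_fderiv one_ne_zero).clm_apply continuous_const)).aestronglyMeasurable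
    · exact (ContinuousLinearMap.le_opNorm _ _).trans
        (mul_le_mul_of_nonneg_right (hM₁ x) (norm_nonneg _))
  have hT2m : ∀ k, MemLp (fun x => fderiv ℝ (fderiv ℝ u) x (b k) (v x)) 2 volume := by
    intro k
    refine MemLp.of_le_mul (c := M₂) hv.memLp_two ?_ (Eventually.of_forall fun x => ?_)
    · exact ((((hu2.fderiv_right (m := 1) le_rfl).continuous_fderiv one_ne_zero).clm_apply continuous_const).clm_apply
        hv.continuous).aestronglyMeasurable
    · calc ‖fderiv ℝ (fderiv ℝ u) x (b k) (v x)‖ ≤ ‖fderiv ℝ (fderiv ℝ u) x (b k)‖ * ‖v x‖ :=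
          ContinuousLinearMap.le_opNorm _ _
        _ ≤ ‖fderiv ℝ (fderiv ℝ u) x‖ * ‖b k‖ * ‖v x‖ := by
          gcongr; exact ContinuousLinearMap.le_opNorm _ _
        _ ≤ M₂ * ‖v x‖ := by
          rw [b.orthonormal.1 k, mul_one]
          exact mul_le_mul_of_nonneg_right (hM₂ x) (norm_nonneg _)
  have hi₁ : ∀ k, Integrable
      (fun x => ⟪fderiv ℝ u x (fderiv ℝ v x (b k)), fderiv ℝ v x (b k)⟫) volume := fun k =>
    integrable_inner_of_memLp_two (hT1m k) ((hv.fderiv_apply (b k)).memLp_two)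
  have hi₂ : ∀ k, Integrable
      (fun x => ⟪fderiv ℝ (fderiv ℝ u) x (b k) (v x), fderiv ℝ v x (b k)⟫) volume := fun k =>
    integrable_inner_of_memLp_two (hT2m k) ((hv.fderiv_apply (b k)).memLp_two)
  have hsq : ∀ k, Integrable (fun x => ‖fderiv ℝ v x (b k)‖ ^ 2) volume := by
    intro k
    have := integrable_inner_of_memLp_two ((hv.fderiv_apply (b k)).memLp_two)
      ((hv.fderiv_apply (b k)).memLp_two)
    exact this.congr (Eventually.of_forall fun x => by simp only [real_inner_self_eq_norm_sq])
  have hcross : ∀ k, Integrable (fun x => ‖v x‖ * ‖fderiv ℝ v x (b k)‖) volume := by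
    intro k
    have := hv.memLp_two.norm.integrable_mul ((hv.fderiv_apply (b k)).memLp_two.norm)
    exact this
  rw [integral_inner_convect_laplacian_eq_neg_sum_sub hu hv]
  -- bound the two sums separately
  have hA : |∑ k, ∫ x, ⟪fderiv ℝ u x (fderiv ℝ v x (b k)), fderiv ℝ v x (b k)⟫| ≤
      σ * ∑ k, ∫ x, ‖fderiv ℝ v x (b k)‖ ^ 2 := by
    rw [Finset.mul_sum]
    refine (Finset.abs_sum_le_sum_abs _ _).trans (Finset.sum_le_sum fun k _ => ?_)
    rw [← integral_const_mul]
    refine (abs_integral_le_integral_abs).trans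
      (integral_mono_of_nonneg (Eventually.of_forall fun x => abs_nonneg _) ((hsq k).const_mul σ)
        (Eventually.of_forall fun x => hσ x _))
  have hB : |∑ k, ∫ x, ⟪fderiv ℝ (fderiv ℝ u) x (b k) (v x), fderiv ℝ v x (b k)⟫| ≤
      σ₂ * ∫ x, ‖v x‖ * ∑ k, ‖fderiv ℝ v x (b k)‖ := by
    have hrep : (fun x => ‖v x‖ * ∑ k, ‖fderiv ℝ v x (b k)‖) =
        fun x => ∑ k, ‖v x‖ * ‖fderiv ℝ v x (b k)‖ := by
      funext x; rw [Finset.mul_sum]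
    rw [hrep, integral_finsetSum _ fun k _ => hcross k, Finset.mul_sum]
    refine (Finset.abs_sum_le_sum_abs _ _).trans (Finset.sum_le_sum fun k _ => ?_)
    rw [← integral_const_mul]
    refine (abs_integral_le_integral_abs).trans
      (integral_mono_of_nonneg (Eventually.of_forall fun x => abs_nonneg _)
        ((hcross k).const_mul σ₂) (Eventually.of_forall fun x => ?_))
    calc |⟪fderiv ℝ (fderiv ℝ u) x (b k) (v x), fderiv ℝ v x (b k)⟫|
        ≤ ‖fderiv ℝ (fderiv ℝ u) x (b k) (v x)‖ * ‖fderiv ℝ v x (b k)‖ := abs_real_inner_le_norm _ _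
      _ ≤ (σ₂ * ‖v x‖) * ‖fderiv ℝ v x (b k)‖ := by
          gcongr
          calc ‖fderiv ℝ (fderiv ℝ u) x (b k) (v x)‖ ≤ ‖fderiv ℝ (fderiv ℝ u) x (b k)‖ * ‖v x‖ :=
                ContinuousLinearMap.le_opNorm _ _
            _ ≤ ‖fderiv ℝ (fderiv ℝ u) x‖ * ‖b k‖ * ‖v x‖ := by
                gcongr; exact ContinuousLinearMap.le_opNorm _ _
            _ ≤ σ₂ * ‖v x‖ := by
                rw [b.orthonormal.1 k, mul_one]
                exact mul_le_mul_of_nonneg_right (hσ₂ x) (norm_nonneg _)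
      _ = σ₂ * (‖v x‖ * ‖fderiv ℝ v x (b k)‖) := by ring
  set S₁ := ∑ k, ∫ x, ⟪fderiv ℝ u x (fderiv ℝ v x (b k)), fderiv ℝ v x (b k)⟫ with hS₁
  set S₂ := ∑ k, ∫ x, ⟪fderiv ℝ (fderiv ℝ u) x (b k) (v x), fderiv ℝ v x (b k)⟫ with hS₂
  have e : -S₁ - S₂ = -(S₁ + S₂) := by ring
  rw [e, abs_neg]
  calc |S₁ + S₂| ≤ |S₁| + |S₂| := abs_add_le _ _
    _ ≤ _ := add_le_add hA hB

end Stretching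

end Summit.NavierStokesRegularity.NavierStokesRegularity.Theorems.StrainPairing

end
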